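import Mathlib
import HarnessLib

/-!
# Zhang (2022) §12 pp. 66–67: window PAIRING — the degenerate-window regime of the absolute-value
# bound for `S_j(𝐛,𝐛̄)` when the coefficients are `O(1)` on a window of logarithmic width `θ`

Topic `Literature/NumberTheory/LFunctions/Zhang2022` (Landau–Siegel audit tree; verdict-neutral).
Y. Zhang, *Discrete mean estimates and the Landau–Siegel zero*, arXiv:2211.02515v1 (2022)
[Zhang2022LandauSiegel], §12 pp. 66–67, tex L3394–L3423: the claims (12.6) and (12.8),
"`ΣΣ𝔠*(ρ,ψ)|H₁₅ − H̃₁₅|²ω(ρ) = o(𝔞𝔓)`" and its dual, which the manuscript settles by the sentence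
"These bounds together with (8.25) and (8.26) imply (12.6)" ((8.25)/(8.26) do not exist in v1) —
**an unrefereed manuscript under adjudication; nothing here asserts or denies its Theorems 1–2.**
ZHANG-L discharge lane, WP12, helper under leaf hXi `Typed.Sec12A.Xi15Hbar16 c′`: the tree reduces
(12.6)/(12.8) to the single arithmetic estimate `S_j(𝐛,𝐛̄) = o(α𝔞)`
(`Typed.Sec12A.eq126_of_sj_small`, `DiscreteMeanSquare.meanSq_le_of_sj_small`), for coefficient
sequences `𝐛` that are `O(1)` on a window `(Xe^{−θ}, Xe^{θ}]` of logarithmic width `θ = 𝓛⁻¹⁰`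
(`X = P^{1/2}`; tree `vk12SubVk1Edges_holds`) and negligible elsewhere (`vk12SubVk1Small_holds`).

In `S_j(𝐚₁,𝐚₂) = Σ_k w_j(k)·M(k)·N(k)` (`k = dr`, `M(k) = Σ_m a₁(km)m^{β_j−1}`,
`N(k) = Σ_n a₂(kn)ξ₀ⱼ(n;d,r)/n`) the window constraint `km, kn ∈ (Xe^{−θ}, Xe^{θ}]` forces
`|log(m/n)| ≤ 2θ`: for `k` close to `X` (height `X/k` small) both inner windows degenerate to one or
two integers `m ≈ n`, and absolute values can only win through this PAIRING — the `k`-sum over the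
window `|log(km/X)| ≤ θ` carries the small factor (`≍ θ`, a short-interval bound for the weights
`w_j`), while the double sum over `m ≈ n` converges like `Σ g(n)/n²`. This file proves that
bookkeeping for ARBITRARY nonnegative weights (pure finite sums; no object of the manuscript enters):

* `abs_log_div_le_of_windows` — `|log(km/X)|, |log(kn/X)| ≤ θ ⇒ |log(m/n)| ≤ 2θ`;
* `sum_window_pair_le` — **pairing**:
  `Σ_k w(k)·(Σ_{m: |log(km/X)|≤θ} F(m))·(Σ_{n: |log(kn/X)|≤θ} G(n))
     ≤ Σ_m Σ_{n: |log(m/n)|≤2θ} F(m)G(n)·Σ_{k: |log(km/X)|≤θ} w(k)`;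
* `sum_window_pair_le_of_weight_le` — the same with a uniform bound `ω` on the `k`-window weights;
* `sum_inv_near_le` — `Σ_{m ≥ 1: |log(m/n)| ≤ 2θ} 1/m ≤ 4e⁴θ + e²/n` (`0 ≤ θ ≤ 1`);
* `sum_pair_div_le` — `Σ_m Σ_{n: |log(m/n)|≤2θ} g(n)/(mn) ≤ 4e⁴θ·Σ_n g(n)/n + e²·Σ_n g(n)/n²`;
* `degenerate_regime_le` — **the degenerate-regime bound**: with `F = B₁/m`, `G = B₂g(n)/n`,
  `k`-window weights `≤ ω`, `Σ_n g(n)/n ≤ Γ₁`, `Σ_n g(n)/n² ≤ Γ₂`: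
  `Σ_k w(k)M⁺(k)N⁺(k) ≤ B₁B₂·ω·(4e⁴θΓ₁ + e²Γ₂)`.

In the application `ω ≍ θ` (short-interval bound for `Σ_{dr=k}|μ(r)||λ₀ⱼ(k)|/(kφ(r)) ≤ 2∏(1+106/q)/k`),
`Γ₁ ≪ (log H₀)⁵`, `Γ₂ ≪ 1` (crude majorant `gC` of `ξ₀ⱼ`), so the degenerate regime costs
`O(B₁B₂θ) = O(𝓛⁻¹⁰) = o(α𝔞)`; the complementary long-window regime is where the true-size
(`Σ_{p≤x}|ξ₀ⱼ(p)|/p = log log x + O(1)`) short-interval mean enters. THEOREMS ONLY; 0 definitions,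
0 new facts.

## References

* Y. Zhang, arXiv:2211.02515v1 (2022), §12 pp. 66–67 ((12.6), (12.8)), §7 Prop. 7.1 (`S_j`).
  [cite: Zhang2022LandauSiegel, §12 (12.6) p.67]
-/

noncomputable section

open Real Finset
open scoped Classical

namespace Literature.NumberTheory.LFunctions.Zhang2022.WindowPairs

/-! ## Two windows at the same `k` force `m ≈ n` -/

/-- If `km` and `kn` both lie in the window `|log(·/X)| ≤ θ`, then `|log(m/n)| ≤ 2θ`.
[cite: Zhang2022LandauSiegel, §12 p.67] -/
theorem abs_log_div_le_of_windows {X θ : ℝ} (hX : 0 < X) {k m n : ℕ} (hk : 0 < k) (hm : 0 < m)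
    (hn : 0 < n) (h1 : |Real.log ((k : ℝ) * (m : ℝ) / X)| ≤ θ)
    (h2 : |Real.log ((k : ℝ) * (n : ℝ) / X)| ≤ θ) :
    |Real.log ((m : ℝ) / (n : ℝ))| ≤ 2 * θ := by
  have hkR : (0 : ℝ) < k := by exact_mod_cast hk
  have hmR : (0 : ℝ) < m := by exact_mod_cast hm
  have hnR : (0 : ℝ) < n := by exact_mod_cast hn
  have e : Real.log ((m : ℝ) / (n : ℝ)) =
      Real.log ((k : ℝ) * (m : ℝ) / X) - Real.log ((k : ℝ) * (n : ℝ) / X) := by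
    rw [Real.log_div hmR.ne' hnR.ne', Real.log_div (by positivity) hX.ne',
      Real.log_div (by positivity) hX.ne', Real.log_mul hkR.ne' hmR.ne', Real.log_mul hkR.ne' hnR.ne']
    ring
  rw [e]
  calc |Real.log ((k : ℝ) * (m : ℝ) / X) - Real.log ((k : ℝ) * (n : ℝ) / X)|
      ≤ |Real.log ((k : ℝ) * (m : ℝ) / X)| + |Real.log ((k : ℝ) * (n : ℝ) / X)| := abs_sub _ _
    _ ≤ θ + θ := add_le_add h1 h2
    _ = 2 * θ := by ring

/-! ## The pairing inequality -/

/-- **Pairing.** For nonnegative `w, F, G` on positive integers (`K, S ⊆ ℕ_{≥1}`), `X > 0`: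
`Σ_{k∈K} w(k)·(Σ_{m∈S, |log(km/X)|≤θ} F(m))·(Σ_{n∈S, |log(kn/X)|≤θ} G(n))
  ≤ Σ_{m∈S} Σ_{n∈S, |log(m/n)|≤2θ} F(m)G(n)·Σ_{k∈K, |log(km/X)|≤θ} w(k)`
— expand, relax the `n`-window to `|log(m/n)| ≤ 2θ` (`abs_log_div_le_of_windows`), and sum over `k`
innermost. [cite: Zhang2022LandauSiegel, §12 p.67] -/
theorem sum_window_pair_le {X θ : ℝ} (hX : 0 < X) (K S : Finset ℕ) (hK : ∀ k ∈ K, 0 < k)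
    (hS : ∀ m ∈ S, 0 < m) (w F G : ℕ → ℝ) (hw : ∀ k, 0 ≤ w k) (hF : ∀ m, 0 ≤ F m)
    (hG : ∀ n, 0 ≤ G n) :
    ∑ k ∈ K, w k *
        ((∑ m ∈ S.filter (fun m : ℕ => |Real.log ((k : ℝ) * (m : ℝ) / X)| ≤ θ), F m) *
          (∑ n ∈ S.filter (fun n : ℕ => |Real.log ((k : ℝ) * (n : ℝ) / X)| ≤ θ), G n)) ≤
      ∑ m ∈ S, ∑ n ∈ S.filter (fun n : ℕ => |Real.log ((m : ℝ) / (n : ℝ))| ≤ 2 * θ),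
        F m * G n * ∑ k ∈ K.filter (fun k : ℕ => |Real.log ((k : ℝ) * (m : ℝ) / X)| ≤ θ), w k := by
  -- Step 1: the left side as a triple sum of indicator terms
  have hL : ∑ k ∈ K, w k *
        ((∑ m ∈ S.filter (fun m : ℕ => |Real.log ((k : ℝ) * (m : ℝ) / X)| ≤ θ), F m) *
          (∑ n ∈ S.filter (fun n : ℕ => |Real.log ((k : ℝ) * (n : ℝ) / X)| ≤ θ), G n)) =
      ∑ k ∈ K, ∑ m ∈ S, ∑ n ∈ S,
        (if |Real.log ((k : ℝ) * (m : ℝ) / X)| ≤ θ ∧ |Real.log ((k : ℝ) * (n : ℝ) / X)| ≤ θ then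
          w k * F m * G n else 0) := by
    refine Finset.sum_congr rfl fun k _ => ?_
    rw [Finset.sum_filter, Finset.sum_filter, Finset.sum_mul_sum, Finset.mul_sum]
    refine Finset.sum_congr rfl fun m _ => ?_
    rw [Finset.mul_sum]
    refine Finset.sum_congr rfl fun n _ => ?_
    by_cases h1 : |Real.log ((k : ℝ) * (m : ℝ) / X)| ≤ θ
    · by_cases h2 : |Real.log ((k : ℝ) * (n : ℝ) / X)| ≤ θ
      · simp only [h1, h2, if_true, and_self]; ring
      · simp only [h1, h2, if_true, if_false, and_false]; ring
    · simp only [h1, if_false, false_and]; ring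
  -- Step 2: the right side as a triple sum of indicator terms, in the order `k, m, n`
  have hR : ∑ m ∈ S, ∑ n ∈ S.filter (fun n : ℕ => |Real.log ((m : ℝ) / (n : ℝ))| ≤ 2 * θ),
        F m * G n * ∑ k ∈ K.filter (fun k : ℕ => |Real.log ((k : ℝ) * (m : ℝ) / X)| ≤ θ), w k =
      ∑ k ∈ K, ∑ m ∈ S, ∑ n ∈ S,
        (if |Real.log ((k : ℝ) * (m : ℝ) / X)| ≤ θ ∧ |Real.log ((m : ℝ) / (n : ℝ))| ≤ 2 * θ then
          w k * F m * G n else 0) := by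
    have h1 : ∑ m ∈ S, ∑ n ∈ S.filter (fun n : ℕ => |Real.log ((m : ℝ) / (n : ℝ))| ≤ 2 * θ),
          F m * G n * ∑ k ∈ K.filter (fun k : ℕ => |Real.log ((k : ℝ) * (m : ℝ) / X)| ≤ θ), w k =
        ∑ m ∈ S, ∑ n ∈ S, ∑ k ∈ K,
          (if |Real.log ((k : ℝ) * (m : ℝ) / X)| ≤ θ ∧ |Real.log ((m : ℝ) / (n : ℝ))| ≤ 2 * θ then
            w k * F m * G n else 0) := by
      refine Finset.sum_congr rfl fun m _ => ?_
      rw [Finset.sum_filter]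
      refine Finset.sum_congr rfl fun n _ => ?_
      by_cases hq : |Real.log ((m : ℝ) / (n : ℝ))| ≤ 2 * θ
      · rw [if_pos hq, Finset.sum_filter, Finset.mul_sum]
        refine Finset.sum_congr rfl fun k _ => ?_
        by_cases hk1 : |Real.log ((k : ℝ) * (m : ℝ) / X)| ≤ θ
        · simp only [hk1, hq, if_true, and_self]; ring
        · simp only [hk1, if_false, false_and]; ring
      · rw [if_neg hq]
        symm
        exact Finset.sum_eq_zero fun k _ => if_neg (fun h => hq h.2)
    rw [h1]
    calc ∑ m ∈ S, ∑ n ∈ S, ∑ k ∈ K,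
          (if |Real.log ((k : ℝ) * (m : ℝ) / X)| ≤ θ ∧ |Real.log ((m : ℝ) / (n : ℝ))| ≤ 2 * θ then
            w k * F m * G n else 0)
        = ∑ m ∈ S, ∑ k ∈ K, ∑ n ∈ S,
          (if |Real.log ((k : ℝ) * (m : ℝ) / X)| ≤ θ ∧ |Real.log ((m : ℝ) / (n : ℝ))| ≤ 2 * θ then
            w k * F m * G n else 0) :=
          Finset.sum_congr rfl fun m _ => Finset.sum_comm
      _ = _ := Finset.sum_comm
  rw [hL, hR]
  -- Step 3: compare termwise
  refine Finset.sum_le_sum fun k hk => Finset.sum_le_sum fun m hm => Finset.sum_le_sum fun n hn => ?_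
  by_cases h : |Real.log ((k : ℝ) * (m : ℝ) / X)| ≤ θ ∧ |Real.log ((k : ℝ) * (n : ℝ) / X)| ≤ θ
  · have hq : |Real.log ((m : ℝ) / (n : ℝ))| ≤ 2 * θ :=
      abs_log_div_le_of_windows hX (hK k hk) (hS m hm) (hS n hn) h.1 h.2
    rw [if_pos h, if_pos ⟨h.1, hq⟩]
  · rw [if_neg h]
    split_ifs
    · exact mul_nonneg (mul_nonneg (hw k) (hF m)) (hG n)
    · exact le_rfl

/-- **Pairing with a uniform bound on the `k`-window weights**: if
`Σ_{k∈K, |log(km/X)|≤θ} w(k) ≤ ω` for every `m ∈ S`, then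
`Σ_k w(k)·M⁺(k)·N⁺(k) ≤ ω·Σ_{m∈S} Σ_{n∈S, |log(m/n)|≤2θ} F(m)G(n)`.
[cite: Zhang2022LandauSiegel, §12 p.67] -/
theorem sum_window_pair_le_of_weight_le {X θ ω : ℝ} (hX : 0 < X) (K S : Finset ℕ)
    (hK : ∀ k ∈ K, 0 < k) (hS : ∀ m ∈ S, 0 < m) (w F G : ℕ → ℝ) (hw : ∀ k, 0 ≤ w k)
    (hF : ∀ m, 0 ≤ F m) (hG : ∀ n, 0 ≤ G n)
    (hω : ∀ m ∈ S, ∑ k ∈ K.filter (fun k : ℕ => |Real.log ((k : ℝ) * (m : ℝ) / X)| ≤ θ), w k ≤ ω) :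
    ∑ k ∈ K, w k *
        ((∑ m ∈ S.filter (fun m : ℕ => |Real.log ((k : ℝ) * (m : ℝ) / X)| ≤ θ), F m) *
          (∑ n ∈ S.filter (fun n : ℕ => |Real.log ((k : ℝ) * (n : ℝ) / X)| ≤ θ), G n)) ≤
      ω * ∑ m ∈ S, ∑ n ∈ S.filter (fun n : ℕ => |Real.log ((m : ℝ) / (n : ℝ))| ≤ 2 * θ),
        F m * G n := by
  refine (sum_window_pair_le hX K S hK hS w F G hw hF hG).trans ?_
  rw [Finset.mul_sum]
  refine Finset.sum_le_sum fun m hm => ?_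
  rw [Finset.mul_sum]
  refine Finset.sum_le_sum fun n _ => ?_
  calc F m * G n * ∑ k ∈ K.filter (fun k : ℕ => |Real.log ((k : ℝ) * (m : ℝ) / X)| ≤ θ), w k
      ≤ F m * G n * ω := mul_le_mul_of_nonneg_left (hω m hm) (mul_nonneg (hF m) (hG n))
    _ = ω * (F m * G n) := by ring

/-! ## The double sum over `m ≈ n` -/

/-- For `n ≥ 1` and `0 ≤ θ ≤ 1`: `Σ_{m∈S, |log(m/n)| ≤ 2θ} 1/m ≤ 4e⁴θ + e²/n` (`S ⊆ ℕ_{≥1}`; the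
integers `m` with `|log(m/n)| ≤ 2θ` lie in `[ne^{−2θ}, ne^{2θ}]`, at most `n(e^{2θ} − e^{−2θ}) + 1` of
them, each `1/m ≤ e^{2θ}/n`). [cite: Zhang2022LandauSiegel, §12 p.67] -/
theorem sum_inv_near_le {θ : ℝ} (hθ0 : 0 ≤ θ) (hθ1 : θ ≤ 1) (S : Finset ℕ) (hS : ∀ m ∈ S, 0 < m)
    {n : ℕ} (hn : 0 < n) :
    ∑ m ∈ S.filter (fun m : ℕ => |Real.log ((m : ℝ) / (n : ℝ))| ≤ 2 * θ), (1 : ℝ) / (m : ℝ) ≤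
      4 * Real.exp 4 * θ + Real.exp 2 / n := by
  have hnR : (0 : ℝ) < n := by exact_mod_cast hn
  set a : ℝ := n * Real.exp (-(2 * θ)) with ha
  set b : ℝ := n * Real.exp (2 * θ) with hb
  have ha0 : 0 < a := by positivity
  have hab : a ≤ b := by
    rw [ha, hb]; gcongr; linarith
  set T := S.filter (fun m : ℕ => |Real.log ((m : ℝ) / (n : ℝ))| ≤ 2 * θ) with hT
  -- every `m` in the filtered set lies in `[a, b]`
  have hmem : ∀ m ∈ T, a ≤ (m : ℝ) ∧ (m : ℝ) ≤ b := by
    intro m hm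
    rw [hT, Finset.mem_filter] at hm
    have hm0 : (0 : ℝ) < m := by exact_mod_cast hS m hm.1
    have h := abs_le.mp hm.2
    have hlog : Real.log ((m : ℝ) / (n : ℝ)) = Real.log m - Real.log n :=
      Real.log_div hm0.ne' hnR.ne'
    rw [hlog] at h
    constructor
    · rw [ha]
      have : Real.log (n * Real.exp (-(2 * θ))) ≤ Real.log m := by
        rw [Real.log_mul hnR.ne' (Real.exp_pos _).ne', Real.log_exp]; linarith
      exact (Real.log_le_log_iff (by positivity) hm0).mp this
    · rw [hb]
      have : Real.log m ≤ Real.log (n * Real.exp (2 * θ)) := by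
        rw [Real.log_mul hnR.ne' (Real.exp_pos _).ne', Real.log_exp]; linarith
      exact (Real.log_le_log_iff hm0 (by positivity)).mp this
  -- the filtered set sits inside the integer interval `[⌈a⌉, ⌊b⌋]`
  have hsub : T ⊆ Finset.Icc ⌈a⌉₊ ⌊b⌋₊ := by
    intro m hm
    obtain ⟨h1, h2⟩ := hmem m hm
    rw [Finset.mem_Icc]
    exact ⟨Nat.ceil_le.mpr h1, Nat.le_floor h2⟩
  -- termwise `1/m ≤ 1/a`
  have hterm : ∀ m ∈ T, (1 : ℝ) / (m : ℝ) ≤ 1 / a := by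
    intro m hm
    exact one_div_le_one_div_of_le ha0 (hmem m hm).1
  have hcard : ((Finset.Icc ⌈a⌉₊ ⌊b⌋₊).card : ℝ) ≤ b - a + 1 := by
    rw [Nat.card_Icc]
    have h2 : (⌊b⌋₊ : ℝ) ≤ b := Nat.floor_le (by positivity)
    have h3 : a ≤ (⌈a⌉₊ : ℝ) := Nat.le_ceil a
    rcases le_or_gt ⌈a⌉₊ (⌊b⌋₊ + 1) with h | h
    · rw [Nat.cast_sub h]; push_cast; linarith
    · rw [Nat.sub_eq_zero_of_le h.le]; push_cast; linarith
  calc ∑ m ∈ T, (1 : ℝ) / (m : ℝ)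
      ≤ ∑ m ∈ T, 1 / a := Finset.sum_le_sum hterm
    _ = (T.card : ℝ) * (1 / a) := by rw [Finset.sum_const, nsmul_eq_mul]
    _ ≤ ((Finset.Icc ⌈a⌉₊ ⌊b⌋₊).card : ℝ) * (1 / a) := by
        gcongr
    _ ≤ (b - a + 1) * (1 / a) := by gcongr
    _ = (Real.exp (2 * θ) * Real.exp (2 * θ) - 1) + Real.exp (2 * θ) / n := by
        rw [ha, hb]
        have hexp : Real.exp (-(2 * θ)) = (Real.exp (2 * θ))⁻¹ := Real.exp_neg _
        have hE : Real.exp (2 * θ) ≠ 0 := (Real.exp_pos _).ne'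
        rw [hexp]
        field_simp
    _ ≤ 4 * Real.exp 4 * θ + Real.exp 2 / n := by
        have h4 : Real.exp (2 * θ) * Real.exp (2 * θ) = Real.exp (4 * θ) := by
          rw [← Real.exp_add]; ring_nf
        rw [h4]
        have hA : Real.exp (4 * θ) - 1 ≤ 4 * Real.exp 4 * θ := by
          -- `e^x − 1 ≤ x e^x ≤ x e^4` for `0 ≤ x = 4θ ≤ 4`
          have hx0 : 0 ≤ 4 * θ := by linarith
          have hx4 : 4 * θ ≤ 4 := by linarith
          have hpos : 0 < Real.exp (4 * θ) := Real.exp_pos _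
          have h1 : Real.exp (4 * θ) - 1 ≤ 4 * θ * Real.exp (4 * θ) := by
            have hineq := Real.add_one_le_exp (-(4 * θ))
            rw [Real.exp_neg] at hineq
            have h2 : (-(4 * θ) + 1) * Real.exp (4 * θ) ≤ 1 := by
              have := mul_le_mul_of_nonneg_right hineq hpos.le
              rwa [inv_mul_cancel₀ hpos.ne'] at this
            nlinarith
          have h2 : 4 * θ * Real.exp (4 * θ) ≤ 4 * θ * Real.exp 4 :=
            mul_le_mul_of_nonneg_left (Real.exp_le_exp.mpr hx4) hx0
          linarith
        have hB : Real.exp (2 * θ) / n ≤ Real.exp 2 / n := by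
          apply div_le_div_of_nonneg_right _ hnR.le
          exact Real.exp_le_exp.mpr (by linarith)
        linarith

/-- **The double sum over `m ≈ n`**: for nonnegative `g` and `0 ≤ θ ≤ 1`,
`Σ_{m∈S} Σ_{n∈S, |log(m/n)|≤2θ} g(n)/(mn) ≤ 4e⁴θ·Σ_{n∈S} g(n)/n + e²·Σ_{n∈S} g(n)/n²`.
[cite: Zhang2022LandauSiegel, §12 p.67] -/
theorem sum_pair_div_le {θ : ℝ} (hθ0 : 0 ≤ θ) (hθ1 : θ ≤ 1) (S : Finset ℕ) (hS : ∀ m ∈ S, 0 < m)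
    (g : ℕ → ℝ) (hg : ∀ n, 0 ≤ g n) :
    ∑ m ∈ S, ∑ n ∈ S.filter (fun n : ℕ => |Real.log ((m : ℝ) / (n : ℝ))| ≤ 2 * θ),
        g n / ((m : ℝ) * (n : ℝ)) ≤
      4 * Real.exp 4 * θ * ∑ n ∈ S, g n / (n : ℝ) +
        Real.exp 2 * ∑ n ∈ S, g n / (n : ℝ) ^ 2 := by
  -- swap the sums: the constraint is symmetric in `m, n`
  have hswap : ∑ m ∈ S, ∑ n ∈ S.filter (fun n : ℕ => |Real.log ((m : ℝ) / (n : ℝ))| ≤ 2 * θ),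
        g n / ((m : ℝ) * (n : ℝ)) =
      ∑ n ∈ S, g n / (n : ℝ) *
        ∑ m ∈ S.filter (fun m : ℕ => |Real.log ((m : ℝ) / (n : ℝ))| ≤ 2 * θ), (1 : ℝ) / (m : ℝ) := by
    have h1 : ∑ m ∈ S, ∑ n ∈ S.filter (fun n : ℕ => |Real.log ((m : ℝ) / (n : ℝ))| ≤ 2 * θ),
          g n / ((m : ℝ) * (n : ℝ)) =
        ∑ m ∈ S, ∑ n ∈ S,
          (if |Real.log ((m : ℝ) / (n : ℝ))| ≤ 2 * θ then g n / ((m : ℝ) * (n : ℝ)) else 0) := by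
      refine Finset.sum_congr rfl fun m _ => ?_
      rw [Finset.sum_filter]
    have h2 : ∑ n ∈ S, g n / (n : ℝ) *
          ∑ m ∈ S.filter (fun m : ℕ => |Real.log ((m : ℝ) / (n : ℝ))| ≤ 2 * θ), (1 : ℝ) / (m : ℝ) =
        ∑ n ∈ S, ∑ m ∈ S,
          (if |Real.log ((m : ℝ) / (n : ℝ))| ≤ 2 * θ then g n / ((m : ℝ) * (n : ℝ)) else 0) := by
      refine Finset.sum_congr rfl fun n hn => ?_
      rw [Finset.sum_filter, Finset.mul_sum]
      refine Finset.sum_congr rfl fun m hm => ?_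
      have hm0 : (m : ℝ) ≠ 0 := by exact_mod_cast (hS m hm).ne'
      have hn0 : (n : ℝ) ≠ 0 := by exact_mod_cast (hS n hn).ne'
      by_cases hq : |Real.log ((m : ℝ) / (n : ℝ))| ≤ 2 * θ
      · rw [if_pos hq, if_pos hq]; field_simp
      · rw [if_neg hq, if_neg hq]; ring
    rw [h1, h2, Finset.sum_comm]
  rw [hswap, Finset.mul_sum, Finset.mul_sum, ← Finset.sum_add_distrib]
  refine Finset.sum_le_sum fun n hn => ?_
  have hn0 : 0 < n := hS n hn
  have hnR : (0 : ℝ) < n := by exact_mod_cast hn0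
  have hgn : 0 ≤ g n / (n : ℝ) := div_nonneg (hg n) hnR.le
  calc g n / (n : ℝ) *
        ∑ m ∈ S.filter (fun m : ℕ => |Real.log ((m : ℝ) / (n : ℝ))| ≤ 2 * θ), (1 : ℝ) / (m : ℝ)
      ≤ g n / (n : ℝ) * (4 * Real.exp 4 * θ + Real.exp 2 / n) :=
        mul_le_mul_of_nonneg_left (sum_inv_near_le hθ0 hθ1 S hS hn0) hgn
    _ = 4 * Real.exp 4 * θ * (g n / (n : ℝ)) + Real.exp 2 * (g n / (n : ℝ) ^ 2) := by
        field_simp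

/-! ## The degenerate-window regime -/

/-- **Degenerate-window regime of the `O(1)`-coefficient window bound.** With `m`-terms majorised
by `B₁/m`, `n`-terms by `B₂g(n)/n` (`g ≥ 0` a uniform majorant of `|ξ₀ⱼ(n;d,r)|`), `k`-window weight
sums `≤ ω`, `Σ_{n∈S} g(n)/n ≤ Γ₁`, `Σ_{n∈S} g(n)/n² ≤ Γ₂` and `0 ≤ θ ≤ 1`:
`Σ_{k∈K} w(k)·(Σ_{m∈S, |log(km/X)|≤θ} B₁/m)·(Σ_{n∈S, |log(kn/X)|≤θ} B₂g(n)/n)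
   ≤ B₁B₂·ω·(4e⁴θΓ₁ + e²Γ₂)`. [cite: Zhang2022LandauSiegel, §12 p.67] -/
theorem degenerate_regime_le {X θ ω B₁ B₂ Γ₁ Γ₂ : ℝ} (hX : 0 < X) (hθ0 : 0 ≤ θ) (hθ1 : θ ≤ 1)
    (hω : 0 ≤ ω) (hB₁ : 0 ≤ B₁) (hB₂ : 0 ≤ B₂) (K S : Finset ℕ) (hK : ∀ k ∈ K, 0 < k)
    (hS : ∀ m ∈ S, 0 < m) (w g : ℕ → ℝ) (hw : ∀ k, 0 ≤ w k) (hg : ∀ n, 0 ≤ g n)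
    (hωk : ∀ m ∈ S, ∑ k ∈ K.filter (fun k : ℕ => |Real.log ((k : ℝ) * (m : ℝ) / X)| ≤ θ), w k ≤ ω)
    (hΓ₁ : ∑ n ∈ S, g n / (n : ℝ) ≤ Γ₁) (hΓ₂ : ∑ n ∈ S, g n / (n : ℝ) ^ 2 ≤ Γ₂) :
    ∑ k ∈ K, w k *
        ((∑ m ∈ S.filter (fun m : ℕ => |Real.log ((k : ℝ) * (m : ℝ) / X)| ≤ θ), B₁ / (m : ℝ)) *
          (∑ n ∈ S.filter (fun n : ℕ => |Real.log ((k : ℝ) * (n : ℝ) / X)| ≤ θ),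
            B₂ * g n / (n : ℝ))) ≤
      B₁ * B₂ * ω * (4 * Real.exp 4 * θ * Γ₁ + Real.exp 2 * Γ₂) := by
  have hF : ∀ m : ℕ, 0 ≤ B₁ / (m : ℝ) := fun m => div_nonneg hB₁ (Nat.cast_nonneg m)
  have hG : ∀ n : ℕ, 0 ≤ B₂ * g n / (n : ℝ) := fun n =>
    div_nonneg (mul_nonneg hB₂ (hg n)) (Nat.cast_nonneg n)
  have h1 := sum_window_pair_le_of_weight_le hX K S hK hS w (fun m => B₁ / (m : ℝ))
    (fun n => B₂ * g n / (n : ℝ)) hw hF hG hωk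
  refine h1.trans ?_
  have hinner : ∑ m ∈ S, ∑ n ∈ S.filter (fun n : ℕ => |Real.log ((m : ℝ) / (n : ℝ))| ≤ 2 * θ),
      B₁ / (m : ℝ) * (B₂ * g n / (n : ℝ)) =
      B₁ * B₂ * ∑ m ∈ S, ∑ n ∈ S.filter (fun n : ℕ => |Real.log ((m : ℝ) / (n : ℝ))| ≤ 2 * θ),
        g n / ((m : ℝ) * (n : ℝ)) := by
    rw [Finset.mul_sum]
    refine Finset.sum_congr rfl fun m hm => ?_
    rw [Finset.mul_sum]
    refine Finset.sum_congr rfl fun n hn => ?_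
    have hm0 : (m : ℝ) ≠ 0 := by exact_mod_cast (hS m hm).ne'
    have hn0 : (n : ℝ) ≠ 0 := by
      rw [Finset.mem_filter] at hn
      exact_mod_cast (hS n hn.1).ne'
    field_simp
  rw [hinner]
  have h2 := sum_pair_div_le hθ0 hθ1 S hS g hg
  have h3 : ∑ m ∈ S, ∑ n ∈ S.filter (fun n : ℕ => |Real.log ((m : ℝ) / (n : ℝ))| ≤ 2 * θ),
      g n / ((m : ℝ) * (n : ℝ)) ≤ 4 * Real.exp 4 * θ * Γ₁ + Real.exp 2 * Γ₂ := by
    refine h2.trans (add_le_add ?_ ?_)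
    · exact mul_le_mul_of_nonneg_left hΓ₁ (by positivity)
    · exact mul_le_mul_of_nonneg_left hΓ₂ (by positivity)
  calc ω * (B₁ * B₂ * ∑ m ∈ S, ∑ n ∈ S.filter (fun n : ℕ => |Real.log ((m : ℝ) / (n : ℝ))| ≤ 2 * θ),
        g n / ((m : ℝ) * (n : ℝ)))
      ≤ ω * (B₁ * B₂ * (4 * Real.exp 4 * θ * Γ₁ + Real.exp 2 * Γ₂)) := by
        apply mul_le_mul_of_nonneg_left _ hω
        exact mul_le_mul_of_nonneg_left h3 (mul_nonneg hB₁ hB₂)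
    _ = B₁ * B₂ * ω * (4 * Real.exp 4 * θ * Γ₁ + Real.exp 2 * Γ₂) := by ring

end Literature.NumberTheory.LFunctions.Zhang2022.WindowPairs
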